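import Summits.ValiantsHypothesis.ValiantsHypothesis.Theorems.BarrierLeverAnchoredDoorHitsLowerPairsBase
import Summits.ValiantsHypothesis.ValiantsHypothesis.Theorems.BarrierLeverAnchoredDoorHitsLowerPairsSwap
import Summits.ValiantsHypothesis.ValiantsHypothesis.Theorems.BarrierLeverAnchoredDoorHitsLowerPairsStubGenericPoint

/-!
# Support item `AnchoredDoorHitsLowerPairs` (stmt-ValiantsHypothesis-22510), line `anchored-peeling`:
# the UQ_s PEELING STEP (up-set with distinct roots) as a typed step, the residual stub, and the kernel-checked induction

Helper file (`--supports stmt-ValiantsHypothesis-22510`; cell valiant-natproofs, rung V4, 𝒟-side door (c); registered line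
`Cruxes/AnchoredDoorHitsLowerPairs/Lines/anchored_peeling.lean` v12; prover seat val-np-p1 gen 19). One decidable bookkeeping predicate (`UQData`), two
`def … : Prop` stub texts OFFERED to the planner under D-0145 (`Stmt.stub_uqStep`, `Stmt.stub_uqResidual` — NOT asserted), and the kernel-checked composition
`stub_symbolicNonvanishing_of_uq : Stmt.stub_uqStep → Stmt.stub_uqResidual → Stmt.stub_symbolicNonvanishing`. Closes NO item.

THE STEP (memo HOME/val-np-p1/g19/PEEL-HALL-valnp1-g19.md §4 + §14, full proof on paper; Lean blueprint HOME/val-np-p1/g19/QSTEP-BLUEPRINT-valnp1-g19.md).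
For an injective simplicial-complex pair `(R, C) = (range u, range w)` at profile `s ≥ 1`, an `x`-vertex `a`, a column vertex `c` with `m := ℓ_c − ℓ_a ≥ 0`
(`ℓ_a = #{i : a ∈ u i}`, `ℓ_c = #{j : c ∈ w j}`), and an UP-SET `𝒜` of the deletion complex `del_a R` with `|𝒜| = m` whose faces admit DISTINCT ROOTS
`ρ A ⊆ A`, `1 ≤ |ρ A| ≤ s` (`UQData`): the two smaller facts `symbolicDet_s(del_a R ∖ 𝒜, del_c C) ≠ 0` and `symbolicDet_s(lk_a R, K₀) ≠ 0` (lower `K₀ ⊆ lk_c C`)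
imply `symbolicDet_s(R, C) ≠ 0`. Mechanism: peel `a` onto `c` (one-type DT stage, p609893), keep at `c` only the anchors `(ρ A | c)`, `A ∈ 𝒜`, with their tails;
after a kernel reduction the coefficient of the private monomial `∏_A θ_{(ρA|c)} φ_{(ρA|c)}^{A∖ρA} ψ_{(ρA|c)}^{T_A}` (`T_A` = echelon leading monomials of the
annihilator of the link rows) in the peeled minor is `± det 𝔄̂[del_a R ∖ 𝒜, del_c C]` (bordered-determinant identity), a minor of a LOWER sub-pair because `𝒜`
is an up-set. `m = 0`, `𝒜 = ∅` is the vertex star step; the thin step and (K₉₀, cube₁₂) at `s = 2` (`𝒜` = 1958 edges of K₈₉ rooted at themselves) are instances.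

* `UQData s u w a c 𝒜 ρ` — the combinatorial data (decidable).
* `Stmt.stub_uqStep` — the step as a stub text (a THEOREM on paper; kernel proof = blueprint modules M0–M4, multi-session).
* `Stmt.stub_uqResidual` — THE RESIDUAL: at some fixed profile `s`, every injective lower pair with `r ≥ 2` admitting NO UQ data on either side still has
  nonzero symbolic minor. Census (lab/uq.py): the residual is EMPTY for all 392 pairs ≤ 4×4 already at `s = 1` and for 2 904/2 904 random wide/deep pairs
  ≤ (10,6) at `s = 2`; its first theoretical members at `s = 2` are «cube₈ versus B(12,3) truncated to 256 faces»-type deep-vs-very-wide pairs (memo §14).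
  WHY IT MIGHT FAIL: that class is infinite for every fixed `s` (cube_n vs truncated `B(q, s+1)`, `q ≳ 2s+7`), and no peeling argument of derivative type reaches it.
* `stub_symbolicNonvanishing_of_uq` — **composition (kernel-checked)**: step ∧ residual ⟹ the line's `Stmt.stub_symbolicNonvanishing` (strong induction on `r` at the
  residual's profile; base `stub_base`; `y`-side data via `symbolicDet_ne_zero_comm`; the two sub-pairs have fewer rows and are again injective lower pairs).

WHAT THIS IS NOT: `Stmt.stub_uqStep` is not yet a kernel theorem (paper proof only); no claim on the residual; nothing on crux stmt-ValiantsHypothesis-14610 or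
on `VP` versus `VNP`.
-/

set_option linter.dupNamespace false

namespace Summit.ValiantsHypothesis.ValiantsHypothesis.Theorems.BarrierLever.AnchoredPeeling

open Finset

noncomputable section

variable {h : ℕ}

/-- **UQ data** for peeling the `x`-vertex `a` onto the column vertex `c` at profile `s`: `a` is used; `𝒜` is a family of deletion faces (faces of
`range u` avoiding `a`), upward closed among the deletion faces, with `ℓ_a + |𝒜| = ℓ_c` (Hall's condition with slack `|𝒜|`); `ρ` assigns to every
`A ∈ 𝒜` a root `ρ A ⊆ A` with `1 ≤ |ρ A| ≤ s`, injectively on `𝒜`. -/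
def UQData (s : ℕ) {r : ℕ} (u w : Fin r → Finset (Fin h)) (a c : Fin h) (𝒜 : Finset (Finset (Fin h)))
    (ρ : Finset (Fin h) → Finset (Fin h)) : Prop :=
  (∃ i, a ∈ u i) ∧
  (∀ A ∈ 𝒜, A ∈ Set.range u ∧ a ∉ A) ∧
  (∀ A ∈ 𝒜, ∀ i, A ⊆ u i → a ∉ u i → u i ∈ 𝒜) ∧
  (Finset.univ.filter (fun i => a ∈ u i)).card + 𝒜.card = (Finset.univ.filter (fun j => c ∈ w j)).card ∧
  (∀ A ∈ 𝒜, ρ A ⊆ A ∧ 1 ≤ (ρ A).card ∧ (ρ A).card ≤ s) ∧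
  Set.InjOn ρ (↑𝒜 : Set (Finset (Fin h)))

/-- **STUB (UQ_s-STEP; a theorem on paper).** Given UQ data at `(a, c)`, non-vanishing of the symbolic minors of the core pairs
`(del_a R ∖ 𝒜, del_c C)` and `(lk_a R, K₀)` (every injective lower `K₀` inside `lk_c C`) implies non-vanishing for `(R, C)`. -/
def Stmt.stub_uqStep : Prop :=
  ∀ (s h r : ℕ) (u w : Fin r → Finset (Fin h)), 1 ≤ s → Function.Injective u → Function.Injective w →
    IsLowerSet (Set.range u) → IsLowerSet (Set.range w) →
    ∀ (a c : Fin h) (𝒜 : Finset (Finset (Fin h))) (ρ : Finset (Fin h) → Finset (Fin h)), UQData s u w a c 𝒜 ρ →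
      (∀ (r₀ : ℕ) (u₀ w₀ : Fin r₀ → Finset (Fin h)), Function.Injective u₀ → Function.Injective w₀ →
          Set.range u₀ = {S | S ∈ Set.range u ∧ a ∉ S ∧ S ∉ 𝒜} → Set.range w₀ = {T | T ∈ Set.range w ∧ c ∉ T} →
          symbolicDet s h r₀ u₀ w₀ ≠ 0) →
      (∀ (r₁ : ℕ) (u₁ w₁ : Fin r₁ → Finset (Fin h)), Function.Injective u₁ → Function.Injective w₁ →
          Set.range u₁ = {S | a ∉ S ∧ insert a S ∈ Set.range u} → Set.range w₁ ⊆ {T | c ∉ T ∧ insert c T ∈ Set.range w} →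
          IsLowerSet (Set.range w₁) → symbolicDet s h r₁ u₁ w₁ ≠ 0) →
      symbolicDet s h r u w ≠ 0

/-- **STUB (THE UQ RESIDUAL).** At some fixed profile `s ≥ 1` and all `h ≥ h₀`: every injective simplicial-complex pair with `r ≥ 2` rows that admits NO
UQ data on the `x`-side and none on the `y`-side still has nonzero symbolic minor. -/
def Stmt.stub_uqResidual : Prop :=
  ∃ s h₀ : ℕ, 1 ≤ s ∧ ∀ h : ℕ, h₀ ≤ h → ∀ (r : ℕ) (u w : Fin r → Finset (Fin h)),
    Function.Injective u → Function.Injective w → IsLowerSet (Set.range u) → IsLowerSet (Set.range w) → 2 ≤ r →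
    (∀ (a c : Fin h) (𝒜 : Finset (Finset (Fin h))) (ρ : Finset (Fin h) → Finset (Fin h)), ¬ UQData s u w a c 𝒜 ρ) →
    (∀ (c a : Fin h) (𝒜 : Finset (Finset (Fin h))) (ρ : Finset (Fin h) → Finset (Fin h)), ¬ UQData s w u c a 𝒜 ρ) →
    symbolicDet s h r u w ≠ 0

/-! ## Size and lower-set bookkeeping for the two sub-pairs -/

section Bookkeeping

variable {r : ℕ}

/-- The image of an injective `r`-family has `r` elements. -/
private theorem card_image_univ' {u : Fin r → Finset (Fin h)} (hu : Function.Injective u) :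
    (Finset.univ.image u).card = r := by
  classical
  rw [Finset.card_image_of_injective _ hu, Finset.card_univ, Fintype.card_fin]

/-- An injective family whose range is a subset of `range u` missing the face `u i₀` is strictly shorter. -/
private theorem lt_of_range_subset_missing {r₀ : ℕ} {u : Fin r → Finset (Fin h)} {u₀ : Fin r₀ → Finset (Fin h)}
    (hu : Function.Injective u) (hu₀ : Function.Injective u₀) (hsub : Set.range u₀ ⊆ Set.range u)
    (i₀ : Fin r) (hmiss : u i₀ ∉ Set.range u₀) : r₀ < r := by
  classical
  have hss : Finset.univ.image u₀ ⊂ Finset.univ.image u := by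
    rw [Finset.ssubset_iff_subset_ne]
    refine ⟨?_, ?_⟩
    · intro x hx
      rw [Finset.mem_image] at hx ⊢
      obtain ⟨i, _, rfl⟩ := hx
      obtain ⟨j, hj⟩ := hsub ⟨i, rfl⟩
      exact ⟨j, Finset.mem_univ _, hj⟩
    · intro heq
      have : u i₀ ∈ Finset.univ.image u₀ := by rw [heq]; exact Finset.mem_image.mpr ⟨i₀, Finset.mem_univ _, rfl⟩
      obtain ⟨i, _, hi⟩ := Finset.mem_image.mp this
      exact hmiss ⟨i, hi⟩
  have := Finset.card_lt_card hss
  rwa [card_image_univ' hu₀, card_image_univ' hu] at this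

/-- The deletion-minus-up-set family is shorter than `u` (it misses a face containing `a`). -/
private theorem lt_of_deletion' {r₀ : ℕ} {u : Fin r → Finset (Fin h)} {u₀ : Fin r₀ → Finset (Fin h)} {a : Fin h}
    {𝒜 : Finset (Finset (Fin h))} (hu : Function.Injective u) (hu₀ : Function.Injective u₀) (ha : ∃ i, a ∈ u i)
    (hr₀ : Set.range u₀ = {S | S ∈ Set.range u ∧ a ∉ S ∧ S ∉ 𝒜}) : r₀ < r := by
  obtain ⟨i₀, hi₀⟩ := ha
  refine lt_of_range_subset_missing hu hu₀ (fun S hS => by rw [hr₀] at hS; exact hS.1) i₀ ?_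
  intro hmem
  rw [hr₀] at hmem
  exact hmem.2.1 hi₀

/-- The link family is shorter than `u` (its `insert a`-image misses `∅`). -/
private theorem lt_of_link' {r₁ : ℕ} {u : Fin r → Finset (Fin h)} {u₁ : Fin r₁ → Finset (Fin h)} {a : Fin h}
    (hu : Function.Injective u) (hu₁ : Function.Injective u₁) (hlu : IsLowerSet (Set.range u)) (ha : ∃ i, a ∈ u i)
    (hr₁ : Set.range u₁ = {S | a ∉ S ∧ insert a S ∈ Set.range u}) : r₁ < r := by
  classical
  have hmem : ∀ i, a ∉ u₁ i ∧ insert a (u₁ i) ∈ Set.range u := fun i => by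
    have hi : u₁ i ∈ Set.range u₁ := ⟨i, rfl⟩
    rw [hr₁] at hi
    exact hi
  let g : Fin r₁ → Finset (Fin h) := fun i => insert a (u₁ i)
  have hg : Function.Injective g := by
    intro i j hij
    apply hu₁
    have h1 : (insert a (u₁ i)).erase a = u₁ i := Finset.erase_insert (hmem i).1
    have h2 : (insert a (u₁ j)).erase a = u₁ j := Finset.erase_insert (hmem j).1
    rw [← h1, ← h2]
    exact congrArg (fun S => Finset.erase S a) hij
  obtain ⟨i₀, hi₀⟩ := ha
  have hempty : (∅ : Finset (Fin h)) ∈ Set.range u := hlu (Finset.empty_subset (u i₀)) ⟨i₀, rfl⟩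
  obtain ⟨j₀, hj₀⟩ := hempty
  refine lt_of_range_subset_missing hu hg ?_ j₀ ?_
  · rintro S ⟨i, rfl⟩
    exact (hmem i).2
  · rintro ⟨i, hi⟩
    have : a ∈ (∅ : Finset (Fin h)) := by rw [← hj₀, ← hi]; exact Finset.mem_insert_self _ _
    exact Finset.notMem_empty _ this

/-- The deletion complex minus an up-set is a lower family. -/
private theorem lowerSet_deletion' {r₀ : ℕ} {u : Fin r → Finset (Fin h)} {u₀ : Fin r₀ → Finset (Fin h)} {a : Fin h}
    {𝒜 : Finset (Finset (Fin h))} (hlu : IsLowerSet (Set.range u)) (hup : ∀ A ∈ 𝒜, ∀ i, A ⊆ u i → a ∉ u i → u i ∈ 𝒜)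
    (hr₀ : Set.range u₀ = {S | S ∈ Set.range u ∧ a ∉ S ∧ S ∉ 𝒜}) : IsLowerSet (Set.range u₀) := by
  rw [hr₀]
  intro S T hTS hS
  obtain ⟨⟨i, hi⟩, haS, hS𝒜⟩ := hS
  refine ⟨hlu hTS ⟨i, hi⟩, fun haT => haS (hTS haT), fun hT𝒜 => hS𝒜 ?_⟩
  have := hup T hT𝒜 i (hi ▸ hTS) (hi ▸ haS)
  rwa [hi] at this

/-- The column deletion complex is a lower family. -/
private theorem lowerSet_colDeletion' {r₀ : ℕ} {w : Fin r → Finset (Fin h)} {w₀ : Fin r₀ → Finset (Fin h)} {c : Fin h}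
    (hlw : IsLowerSet (Set.range w)) (hr₀ : Set.range w₀ = {T | T ∈ Set.range w ∧ c ∉ T}) : IsLowerSet (Set.range w₀) := by
  rw [hr₀]
  intro S T hTS hS
  exact ⟨hlw hTS hS.1, fun hcT => hS.2 (hTS hcT)⟩

/-- The link of a vertex is a lower family. -/
private theorem lowerSet_link' {r₁ : ℕ} {u : Fin r → Finset (Fin h)} {u₁ : Fin r₁ → Finset (Fin h)} {a : Fin h}
    (hlu : IsLowerSet (Set.range u)) (hr₁ : Set.range u₁ = {S | a ∉ S ∧ insert a S ∈ Set.range u}) :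
    IsLowerSet (Set.range u₁) := by
  rw [hr₁]
  intro S T hTS hS
  exact ⟨fun haT => hS.1 (hTS haT), hlu (Finset.insert_subset_insert a hTS) hS.2⟩

end Bookkeeping

/-- **THE INDUCTION (kernel-checked): UQ_s-step ∧ UQ-residual ⟹ the line's symbolic non-vanishing stub.** At the residual's profile `s` and `h ≥ h₀`, by
strong induction on `r`: `r ≤ 1` by `stub_base`; otherwise either UQ data exist on the `x`-side (apply the step; both sub-pairs are injective lower pairs with
fewer rows), or on the `y`-side (the same for the swapped pair, `symbolicDet_ne_zero_comm`), or on neither side (the residual stub). -/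
theorem stub_symbolicNonvanishing_of_uq (hstep : Stmt.stub_uqStep) (hres : Stmt.stub_uqResidual) :
    Stmt.stub_symbolicNonvanishing := by
  obtain ⟨s, h₀, hs, hR⟩ := hres
  refine ⟨s, h₀, fun h hh => ?_⟩
  intro r
  induction r using Nat.strong_induction_on with
  | _ r ih =>
    intro u w hu hw hlu hlw
    by_cases hr : r ≤ 1
    · exact stub_base s h r u w hu hw hlu hlw hr
    · have hr2 : 2 ≤ r := by omega
      by_cases hx : ∃ (a c : Fin h) (𝒜 : Finset (Finset (Fin h))) (ρ : Finset (Fin h) → Finset (Fin h)), UQData s u w a c 𝒜 ρ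
      · obtain ⟨a, c, 𝒜, ρ, hD⟩ := hx
        have ha : ∃ i, a ∈ u i := hD.1
        have hup := hD.2.2.1
        refine hstep s h r u w hs hu hw hlu hlw a c 𝒜 ρ hD ?_ ?_
        · intro r₀ u₀ w₀ hu₀ hw₀ hru₀ hrw₀
          exact ih r₀ (lt_of_deletion' hu hu₀ ha hru₀) u₀ w₀ hu₀ hw₀ (lowerSet_deletion' hlu hup hru₀)
            (lowerSet_colDeletion' hlw hrw₀)
        · intro r₁ u₁ w₁ hu₁ hw₁ hru₁ _ hlw₁
          exact ih r₁ (lt_of_link' hu hu₁ hlu ha hru₁) u₁ w₁ hu₁ hw₁ (lowerSet_link' hlu hru₁) hlw₁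
      · by_cases hy : ∃ (c a : Fin h) (𝒜 : Finset (Finset (Fin h))) (ρ : Finset (Fin h) → Finset (Fin h)), UQData s w u c a 𝒜 ρ
        · obtain ⟨c, a, 𝒜, ρ, hD⟩ := hy
          have hc : ∃ j, c ∈ w j := hD.1
          have hup := hD.2.2.1
          refine (symbolicDet_ne_zero_comm s h r u w).mpr (hstep s h r w u hs hw hu hlw hlu c a 𝒜 ρ hD ?_ ?_)
          · intro r₀ u₀ w₀ hu₀ hw₀ hru₀ hrw₀
            exact ih r₀ (lt_of_deletion' hw hu₀ hc hru₀) u₀ w₀ hu₀ hw₀ (lowerSet_deletion' hlw hup hru₀)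
              (lowerSet_colDeletion' hlu hrw₀)
          · intro r₁ u₁ w₁ hu₁ hw₁ hru₁ _ hlw₁
            exact ih r₁ (lt_of_link' hw hu₁ hlw hc hru₁) u₁ w₁ hu₁ hw₁ (lowerSet_link' hlw hru₁) hlw₁
        · push Not at hx hy
          exact hR h hh r u w hu hw hlu hlw hr2 (fun a c 𝒜 ρ => hx a c 𝒜 ρ) (fun c a 𝒜 ρ => hy c a 𝒜 ρ)

/-- Hence an anchored hit at the residual's profile (the landed `stub_genericPoint`), in the shape the skeleton composes into the item. -/
theorem anchoredHit_of_uq (hstep : Stmt.stub_uqStep) (hres : Stmt.stub_uqResidual) :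
    ∃ s h₀ : ℕ, ∀ h : ℕ, h₀ ≤ h → ∀ (r : ℕ) (u w : Fin r → Finset (Fin h)),
      Function.Injective u → Function.Injective w → IsLowerSet (Set.range u) → IsLowerSet (Set.range w) → AnchoredHit s h r u w := by
  obtain ⟨s, h₀, H⟩ := stub_symbolicNonvanishing_of_uq hstep hres
  exact ⟨s, h₀, fun h hh r u w hu hw hlu hlw => stub_genericPoint s h r u w (H h hh r u w hu hw hlu hlw)⟩

end

end Summit.ValiantsHypothesis.ValiantsHypothesis.Theorems.BarrierLever.AnchoredPeeling
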